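import Literature.MathematicalPhysics.QuantumLattice.FermionOperators
import HarnessLib

/-!
# Discharge of `spinSq_eq_sum_spinVecF_sq`: `S² = (S^x)² + (S^y)² + (S^z)²`

Trunk T-QLATTICE, family `hubbard`. Sibling proof file of
`Literature/MathematicalPhysics/QuantumLattice/FermionOperators.lean`; no statement is introduced
or changed.

Proved here: Wave0's total-spin Casimir of the Hubbard model,
`spinSq = (S^z)² + ½ (S⁺ S⁻ + S⁻ S⁺)` (`S⁻ = (S⁺)ᴴ`), equals `Σ_{α} (S^α)²` for the spin vector
`spinVecF = (½ (S⁺ + S⁻), (-i/2) (S⁺ - S⁻), S^z)` of `FermionOperators.lean` — the statement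
`Literature.MathematicalPhysics.QuantumLattice.spinSq_eq_sum_spinVecF_sq`, discharged as
`spinSq_eq_sum_spinVecF_sq_holds`.

Sources. Tasaki defines the spin operators of the Hubbard model by
`S^α_x = ½ Σ_{σ,τ} c†_{xσ} (p^α)_{στ} c_{xτ}` (Pauli matrices `p^α`), `S^α_tot = Σ_x S^α_x`, and
the total spin by `(S_tot)² = Σ_{α=1}^{3} (S^α_tot)²` with eigenvalues `S_tot (S_tot + 1)`
(Tasaki, *The Hubbard model — an introduction and selected rigorous results*, J. Phys.: Condens.
Matter 10 (1998) 4353, §2.2 "Some physical quantities"; the same material is §9.2–9.3 of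
Tasaki's 2020 book). With `↑ = 0`, `↓ = 1` these are exactly `spinVecF 0, 1, 2`, since the
ladder operators are `S^± = S^x ± i S^y`, `S⁺ = Σ_x c†_{x↑} c_{x↓}`, `S⁻ = Σ_x c†_{x↓} c_{x↑}`
(Essler–Frahm–Göhmann–Klümper–Korepin, *The One-Dimensional Hubbard Model* (2005) §2.2.5,
eqs. (2.66), (2.78)).

Proof. The printed sources state the identity without proof; it is the polynomial identity
`(½(P + M))² + ((-i/2)(P - M))² = ¼ (P² + PM + MP + M²) - ¼ (P² - PM - MP + M²) = ½ (PM + MP)`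
in the (noncommutative) operator algebra, with `P = S⁺`, `M = S⁻` (`sq_spinX_add_sq_spinY`);
no (anti)commutation relation and no property of the lattice is used.
-/

namespace Literature.MathematicalPhysics.QuantumLattice

open Matrix Finset HubbardWave0

section Algebra

variable {A : Type*} [Ring A] [Module ℂ A] [IsScalarTower ℂ A A] [SMulCommClass ℂ A A]

/-- The angular-momentum identity `(S^x)² + (S^y)² = ½ (S⁺ S⁻ + S⁻ S⁺)` for
`S^x = ½ (S⁺ + S⁻)`, `S^y = (-i/2) (S⁺ - S⁻)`, as a polynomial identity in an arbitrary
(noncommutative) complex algebra: for all `P`, `M`,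
`(½(P + M))² + ((-i/2)(P - M))² = ½ (PM + MP)`. [folklore] -/
theorem sq_spinX_add_sq_spinY (P M : A) :
    (1 / 2 : ℂ) • (P + M) * ((1 / 2 : ℂ) • (P + M)) +
        (-Complex.I / 2) • (P - M) * ((-Complex.I / 2) • (P - M)) =
      (1 / 2 : ℂ) • (P * M + M * P) := by
  have hI : -Complex.I / 2 * (-Complex.I / 2) = (-(1 / 4) : ℂ) := by
    rw [neg_div, neg_mul_neg, div_mul_div_comm, Complex.I_mul_I]
    norm_num
  simp only [smul_mul_assoc, mul_smul_comm, smul_smul, hI, mul_add, add_mul, mul_sub, sub_mul,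
    smul_add, smul_sub]
  module

end Algebra

section Hubbard

variable {Λ : Type*} [LinearOrder Λ] [Fintype Λ]

/-- **Discharge of `spinSq_eq_sum_spinVecF_sq`.** Wave0's Casimir
`spinSq = (S^z)² + ½ (S⁺ S⁻ + S⁻ S⁺)` is the total spin `(S_tot)² = Σ_{α=1}^3 (S^α_tot)²` of
Tasaki (1998) §2.2 for the spin vector `spinVecF = (½(S⁺ + S⁻), (-i/2)(S⁺ - S⁻), S^z)`
(`S^± = S^x ± i S^y`, Essler et al. (2005) (2.78)); by `sq_spinX_add_sq_spinY`.
[cite: Tasaki1998, §2.2] -/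
theorem spinSq_eq_sum_spinVecF_sq_holds : spinSq_eq_sum_spinVecF_sq (Λ := Λ) := by
  unfold spinSq_eq_sum_spinVecF_sq
  rw [Fin.sum_univ_three]
  simp only [spinVecF, Matrix.cons_val_zero, Matrix.cons_val_one, Matrix.cons_val_two,
    Matrix.head_cons, Matrix.tail_cons]
  rw [sq_spinX_add_sq_spinY, spinSq, spinMinus, add_comm]

end Hubbard

end Literature.MathematicalPhysics.QuantumLattice
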